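/-
Copyright: lit-balaban Phase-2 proof seat p08 (gen 10).  Statement-level skeleton of a published paper; no proof claims beyond what
the kernel checks below.
-/
import Literature.MathematicalPhysics.QuantumFieldTheory.BalabanImbrieJaffe1984to88.BIJ88W1Prime543Torus

/-!
# `BalabanImbrieJaffe1984to88.BIJ88W1Prime543CurlDivTorus` — T. Bałaban, J. Imbrie, A. Jaffe, *Effective action and cluster properties of
the abelian Higgs model*, Commun. Math. Phys. **114** (1988) 257–315 [BalabanImbrieJaffe1988], §5.4 p. 282 [PDF 26]: **THE OUTPUT
DERIVATIVES `∂w′₁` AND `∂*w′₁` OF THE TAIL KERNEL `w′₁ = (𝒟_k − 𝒟_{k,loc})∂*Q^{e*}_k∂□` OF (5.4.3) ON THE TORI — DEFINITIONS WITH BODY, RANGE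
CLAUSES, AND THE EXACT REDUCTIONS `(∂w′₁)(p, b′) = Σ_{p′} (∂□e_{b′})(p′)·Σ_{j<k} (∂T_j)(p, p′)`, `(∂*w′₁)(x, b′) = Σ_{p′} (∂□e_{b′})(p′)·Σ_{j<k}
(∂*T_j)(x, p′)`** in which the output derivative lands on the LEFT factor `H_j(·, b₁)`, `H_{j,loc}(·, b₁)` of every tail term only, plus the
three-term telescoped split of `∂T_j` / `∂*T_j` consumed by the estimate.  This is the ∂-side FILE 1 of the p02/p08 split (HOME/STATUS
2026-08-22T02:38Z / 02:47Z) of r16's flip condition for row C2.Eq5.4.7; it sits ON TOP of p02 gen 12's `BIJ88W1Prime543Torus` (the kernel `w′₁`,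
its reduction `w1P_eq_sum`, the tail terms `tT` = `T_j(b, p′)`), imported BY NAME.  Algebra only; the ∂-side estimate (the printed
`|(∂w′₁)(p,b′)| ≦ Σ_j (L^jη)^{−2}e^{−cr(e_j)}e^{−c dist(p,b′)} ≦ e^{−cr(e_k)}e^{−c dist(p,b′)}`) is the sequel, on top of p02's `BIJ88W1Prime543Bound`
and this seat's left-difference lemmas (`BIJ88OpCloseDkLocGradTorus.abs_hKer_shift_sub_le`, `abs_grad_hKer_sub_hlKer_le`).

statement-level skeleton of published theorems with citation tags; proofs where landed; nothing here is a claim about the Yang–Mills mass gap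

PDF held: `paper:balaban1988-cmp114-bij-abelian-higgs-effective-action` (journal page = PDF page + 256).  Page read this session on the text
layer p0026.txt (tl.4–9: «(5.4.3) The kernel w′₁ = (𝒟_k − 𝒟_{k,loc})∂*Q^{e*}_k∂□ involves only the tails not included in the expansion (2.12).
Using the regularity and exponential decay of H_j, H_{j,loc}, along with (2.7) and scaling properties of these kernels, we find that
[display] and similarly for w′₁, ∂*w′₁.»; the display itself is garbled on the layer and is quoted from p02's / r16's image reading below).

CITATION HEADER (lean-in-tree rule).  Part of the lit-balaban TYPED SKELETON (HOME `run/shared/lean/pub/lit-balaban/`), Phase-2 proof seat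
p08 (gen 10), unit `lit-balaban-p08`; free-target protocol G.5-34(d), TAKING line HOME/STATUS.md 2026-08-22T03:04:57Z.  WHAT IS REPRODUCED =
SKELETON row **C2.Eq5.4.7** (owner r16 `lit-balaban-r16/ROWS-C2-part2.md`, referee ref-5), the output derivatives `∂w′₁`, `∂*w′₁` of the
kernel `w′₁` of (5.4.3) p. 282, kind «model instance for the kernels of record» (r16's flip condition «w′₁ tails composition», ∂-members).
Decls of record used BY NAME (nothing restated): p02's `BIJ88W1Prime543Torus.w1P` / `tT` / `gT` / `glT` / `boxSingle` / `w1P_eq_sum` /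
`w1P_eq_zero_of_chi`; r18's `BIJ88CurlyDkLocTorus.hKer` / `hlKer` / `cKer` / `clKer`; `LatticeFieldCalculus.curl` (`∂`, (I.1.2)) and `diverg`
(`∂*`, (I.1.21)).

THE PRINTED TEXT (p. 282 [PDF 26]; display per p02's image reading `HOME/lit-balaban-r16/renders/cmp114/original-p026-x2.png`, quoted in
`BIJ88W1Prime543Torus`): *"The kernel w′₁ = (𝒟_k − 𝒟_{k,loc})∂*Q^{e*}_k∂□ involves only the tails not included in the expansion (2.12). Using
the regularity and exponential decay of H_j, H_{j,loc}, along with (2.7) and scaling properties of these kernels, we find that |(∂w′₁)(p,b′)| ≦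
Σ_{j=1}^{k−1}(L^jη)^{−1−(d−2)−1+(d−2)}e^{−cr(e_j)}e^{−c dist(p,b′)} ≦ e^{−cr(e_k)}e^{−c dist(p,b′)}, and similarly for w′₁, ∂*w′₁. Also, w′₁ is
finite ranged in the sense that w′₁ = w′₁□"*.

THE READING (objects of record, as in `BIJ88W1Prime543Torus`; `U = 1`, real abelian fields, torus `T_η`, `η = L^{−k}`, standing range
`k ≤ m + K`, `d ≥ 2`).  `w′₁(b, b′)` = p02's `w1P hd ρ k χ b b′` (`b` an `η`-bond, `b′` a unit bond); `∂` on the output variable = the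
`η`-lattice curl `curl (L^k)` ((I.1.2) with the factor `η⁻¹ = L^k`), `∂*` on the output variable = the `η`-lattice divergence `diverg (L^k)`
((I.1.21)); so `(∂w′₁)(p, b′) := (∂^η[w′₁(·, b′)])(p)` = `dw1P`, `(∂*w′₁)(x, b′) := (∂^{η*}[w′₁(·, b′)])(x)` = `sw1P`, and termwise
`(∂T_j)(p, p′)` = `dtT`, `(∂*T_j)(x, p′)` = `stT`.

WHAT IS PROVED (0 `sorry`, standard axioms; definitions with bodies + theorems):
* §0 the output curl / divergence at a cell as LINEAR FUNCTIONALS on fine 1-forms (`curlAt`, `divAt`) — the only mechanism used.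
* §1 the definitions; §2 RANGE CLAUSES `dw1P_eq_zero_of_chi`, `sw1P_eq_zero_of_chi` («w′₁ = w′₁□» passes to the derivatives).
* §3 THE EXACT REDUCTIONS: the function-level form `w1P_fun_eq` of p02's `w1P_eq_sum`, the generic `map_w1P_eq_sum` (ANY linear functional of
  the output variable passes inside the reduction), **`dw1P_eq_sum`**, **`sw1P_eq_sum`**, and `abs_dw1P_le_sum`, `abs_sw1P_le_sum`.
* §4 THE TERMS: `tT_fun_eq` (`T_j(·, p′)` as a linear combination of the columns `H_j(·, b₁)`, `H_{j,loc}(·, b₁)`), the generic `map_tT_eq_sum`,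
  **`dtT_eq_sum`** / **`stT_eq_sum`** (`(∂T_j)(p,p′) = Σ_{b₁,b₂}[(∂H_j(·,b₁))(p)C^{(j)}(b₁,b₂)G_j(b₂;p′) − (∂H_{j,loc}(·,b₁))(p)C^{(j)}_{loc}(b₁,b₂)
  G_{j,loc}(b₂;p′)]`), and the telescoped three-term splits `map_tT_eq_telescope`, **`dtT_eq_telescope`**, **`stT_eq_telescope`**
  (`∂(H − H_loc)·CG + ∂H_loc·(C − C_loc)G + ∂H_loc·C_loc(G − G_loc)`), the shape the ∂-side estimate bounds factor by factor.
(The LEFT-FACTOR BOUNDS — the output curl / divergence of the columns `H_j(·,b₁)`, `H_{j,loc}(·,b₁)`, `(H_j − H_{j,loc})(·,b₁)` with the printed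
`(L^jη)^{−1}` gain — are this seat's separate `BIJ88W1PrimeCurlLeftFactorTorus`, independent of p02's files.)
HONEST SCOPE.  (i) Definitions + algebra only; no estimate.  (ii) `∂`, `∂*` act on the OUTPUT (fine, `η`-bond) variable of `w′₁(b, b′)`, as in
the printed `(∂w′₁)(p, b′)`; the input variable `b′` is a unit bond as in p02's file.  (iii) `U = 1`, real abelian fields, torus, standing range,
`2 ≤ d`.  (iv) No new named fact; NOT summit progress.  Unit `lit-balaban-p08` (literature-prover-lit-balaban-p08-g10-0), 2026-08-22.
-/

open scoped BigOperators RealInnerProductSpace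

namespace Literature.MathematicalPhysics.QuantumFieldTheory.BalabanImbrieJaffe1984to88.BIJ88W1Prime543CurlDivTorus

open Balaban1983to89 hiding Site Plaq
open Balaban1983to89.LatticeFieldCalculus
open BIJ85CellAverages
open BIJ88CurlyDkLocTorus
open BIJ88W1Prime543Torus
-- inside this namespace the bare `Site`/`Plaq` are the `ℤ^d` carriers of the QFT root; the torus ones are renamed:
open Balaban1983to89 renaming Site → TSite, Plaq → TPlaq

noncomputable section

variable {P : Params}

/-! ## §0  The output curl / divergence at a cell are linear functionals on fine 1-forms -/

/-- `A ↦ (∂A)(p)` (the curl (I.1.2) with factor `c`, read at one plaquette) as a linear functional. [cite: Balaban1984PropagatorsI, (1.2) p.18] -/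
def curlAt {n : ℕ} (c : ℝ) (p : TPlaq P n) : (PBond P n → ℝ) →ₗ[ℝ] ℝ where
  toFun A := curl c A p
  map_add' A B := by
    simp only [curl, Pi.add_apply, smul_eq_mul]
    ring
  map_smul' r A := by
    simp only [curl, Pi.smul_apply, smul_eq_mul, RingHom.id_apply]
    ring

/-- unfolding `curlAt`. [cite: Balaban1984PropagatorsI, (1.2) p.18] -/
theorem curlAt_apply {n : ℕ} (c : ℝ) (p : TPlaq P n) (A : PBond P n → ℝ) : curlAt c p A = curl c A p := rfl

/-- `A ↦ (∂*A)(x)` (the divergence (I.1.21) with factor `c`, read at one site) as a linear functional.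
[cite: Balaban1984PropagatorsI, (1.21) p.21] -/
def divAt {n : ℕ} (c : ℝ) (x : TSite P n) : (PBond P n → ℝ) →ₗ[ℝ] ℝ where
  toFun A := diverg c A x
  map_add' A B := by
    simp only [diverg, Pi.add_apply, smul_eq_mul, ← Finset.sum_add_distrib]
    exact Finset.sum_congr rfl fun μ _ => by ring
  map_smul' r A := by
    simp only [diverg, Pi.smul_apply, smul_eq_mul, RingHom.id_apply, Finset.mul_sum]
    exact Finset.sum_congr rfl fun μ _ => by ring

/-- unfolding `divAt`. [cite: Balaban1984PropagatorsI, (1.21) p.21] -/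
theorem divAt_apply {n : ℕ} (c : ℝ) (x : TSite P n) (A : PBond P n → ℝ) : divAt c x A = diverg c A x := rfl

/-! ## §1  The output derivatives of `w′₁` and of the tail terms `T_j` -/

variable {k : ℕ}

/-- **`(∂w′₁)(p, b′)`** := the `η`-lattice curl, in the output variable, of `b ↦ w′₁(b, b′)` at the fine plaquette `p` (`∂^η = curl (L^k)`).
[cite: BalabanImbrieJaffe1988, (5.4.3) p.282] -/
def dw1P (hd : 2 ≤ P.d) (ρ : ℕ → ℝ) (k : ℕ) (χ : PBond P k → ℝ) (p : TPlaq P 0) (b' : PBond P k) : ℝ :=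
  curl ((P.L : ℝ) ^ k) (fun b : PBond P 0 => w1P hd ρ k χ b b') p

/-- **`(∂*w′₁)(x, b′)`** := the `η`-lattice divergence, in the output variable, of `b ↦ w′₁(b, b′)` at the fine site `x` (`∂^{η*} = diverg (L^k)`).
[cite: BalabanImbrieJaffe1988, (5.4.3) p.282] -/
def sw1P (hd : 2 ≤ P.d) (ρ : ℕ → ℝ) (k : ℕ) (χ : PBond P k → ℝ) (x : TSite P 0) (b' : PBond P k) : ℝ :=
  diverg ((P.L : ℝ) ^ k) (fun b : PBond P 0 => w1P hd ρ k χ b b') x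

/-- `(∂T_j)(p, p′)` := the output curl of `b ↦ T_j(b, p′)`. [cite: BalabanImbrieJaffe1988, (5.4.3) p.282] -/
def dtT (hd : 2 ≤ P.d) (ρ : ℕ → ℝ) (k j : ℕ) (p : TPlaq P 0) (p' : TPlaq P k) : ℝ :=
  curl ((P.L : ℝ) ^ k) (fun b : PBond P 0 => tT hd ρ k j b p') p

/-- `(∂*T_j)(x, p′)` := the output divergence of `b ↦ T_j(b, p′)`. [cite: BalabanImbrieJaffe1988, (5.4.3) p.282] -/
def stT (hd : 2 ≤ P.d) (ρ : ℕ → ℝ) (k j : ℕ) (x : TSite P 0) (p' : TPlaq P k) : ℝ :=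
  diverg ((P.L : ℝ) ^ k) (fun b : PBond P 0 => tT hd ρ k j b p') x

/-- `dw1P` is the functional `curlAt` at the column `w′₁(·, b′)`. [cite: BalabanImbrieJaffe1988, (5.4.3) p.282] -/
theorem dw1P_eq_curlAt (hd : 2 ≤ P.d) (ρ : ℕ → ℝ) (χ : PBond P k → ℝ) (p : TPlaq P 0) (b' : PBond P k) :
    dw1P hd ρ k χ p b' = curlAt ((P.L : ℝ) ^ k) p (fun b : PBond P 0 => w1P hd ρ k χ b b') := rfl

/-- `sw1P` is the functional `divAt` at the column `w′₁(·, b′)`. [cite: BalabanImbrieJaffe1988, (5.4.3) p.282] -/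
theorem sw1P_eq_divAt (hd : 2 ≤ P.d) (ρ : ℕ → ℝ) (χ : PBond P k → ℝ) (x : TSite P 0) (b' : PBond P k) :
    sw1P hd ρ k χ x b' = divAt ((P.L : ℝ) ^ k) x (fun b : PBond P 0 => w1P hd ρ k χ b b') := rfl

/-! ## §2  Range clauses: «w′₁ = w′₁□» passes to `∂w′₁`, `∂*w′₁` -/

/-- for `b′ ∉ □` the column `w′₁(·, b′)` is the zero 1-form (p02's `w1P_eq_zero_of_chi`, function form).
[cite: BalabanImbrieJaffe1988, (5.4.3) p.282] -/
theorem w1P_fun_eq_zero_of_chi (hd : 2 ≤ P.d) (ρ : ℕ → ℝ) {χ : PBond P k → ℝ} {b' : PBond P k} (h : χ b' = 0) :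
    (fun b : PBond P 0 => w1P hd ρ k χ b b') = 0 := by
  funext b
  exact w1P_eq_zero_of_chi hd ρ b h

/-- **RANGE CLAUSE FOR `∂w′₁`**: `□(b′) = 0 ⟹ (∂w′₁)(p, b′) = 0` for every fine plaquette `p`. [cite: BalabanImbrieJaffe1988, (5.4.3) p.282] -/
theorem dw1P_eq_zero_of_chi (hd : 2 ≤ P.d) (ρ : ℕ → ℝ) {χ : PBond P k → ℝ} (p : TPlaq P 0) {b' : PBond P k} (h : χ b' = 0) :
    dw1P hd ρ k χ p b' = 0 := by
  rw [dw1P_eq_curlAt, w1P_fun_eq_zero_of_chi hd ρ h, map_zero]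

/-- **RANGE CLAUSE FOR `∂*w′₁`**: `□(b′) = 0 ⟹ (∂*w′₁)(x, b′) = 0` for every fine site `x`. [cite: BalabanImbrieJaffe1988, (5.4.3) p.282] -/
theorem sw1P_eq_zero_of_chi (hd : 2 ≤ P.d) (ρ : ℕ → ℝ) {χ : PBond P k → ℝ} (x : TSite P 0) {b' : PBond P k} (h : χ b' = 0) :
    sw1P hd ρ k χ x b' = 0 := by
  rw [sw1P_eq_divAt, w1P_fun_eq_zero_of_chi hd ρ h, map_zero]

/-! ## §3  The exact reductions for `∂w′₁`, `∂*w′₁` -/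

/-- p02's reduction at the level of the column: `w′₁(·, b′) = Σ_{p′} (∂□e_{b′})(p′)·Σ_{j<k} T_j(·, p′)` as fine 1-forms.
[cite: BalabanImbrieJaffe1988, (5.4.3) p.282] -/
theorem w1P_fun_eq (hd : 2 ≤ P.d) (ρ : ℕ → ℝ) (χ : PBond P k → ℝ) (b' : PBond P k) :
    (fun b : PBond P 0 => w1P hd ρ k χ b b') =
      ∑ p' : TPlaq P k, curl 1 (boxSingle χ b') p' • ∑ j ∈ Finset.range k, fun b : PBond P 0 => tT hd ρ k j b p' := by
  funext b
  simp only [Finset.sum_apply, Pi.smul_apply, smul_eq_mul]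
  exact w1P_eq_sum hd ρ χ b b'

/-- **ANY LINEAR FUNCTIONAL OF THE OUTPUT VARIABLE PASSES INSIDE THE REDUCTION**: for `Φ` linear on fine 1-forms,
`Φ[w′₁(·, b′)] = Σ_{p′} (∂□e_{b′})(p′)·Σ_{j<k} Φ[T_j(·, p′)]`. [cite: BalabanImbrieJaffe1988, (5.4.3) p.282] -/
theorem map_w1P_eq_sum (Φ : (PBond P 0 → ℝ) →ₗ[ℝ] ℝ) (hd : 2 ≤ P.d) (ρ : ℕ → ℝ) (χ : PBond P k → ℝ) (b' : PBond P k) :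
    Φ (fun b : PBond P 0 => w1P hd ρ k χ b b') =
      ∑ p' : TPlaq P k, curl 1 (boxSingle χ b') p' * ∑ j ∈ Finset.range k, Φ (fun b : PBond P 0 => tT hd ρ k j b p') := by
  rw [w1P_fun_eq, map_sum]
  refine Finset.sum_congr rfl fun p' _ => ?_
  rw [map_smul, map_sum, smul_eq_mul]

/-- **THE EXACT REDUCTION OF `∂w′₁` ON THE TORUS**: `(∂w′₁)(p, b′) = Σ_{p′∈T₁^{(k)}} (∂□e_{b′})(p′)·Σ_{j<k} (∂T_j)(p, p′)` for every fine
plaquette `p` and unit bond `b′`. [cite: BalabanImbrieJaffe1988, (5.4.3) p.282] -/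
theorem dw1P_eq_sum (hd : 2 ≤ P.d) (ρ : ℕ → ℝ) (χ : PBond P k → ℝ) (p : TPlaq P 0) (b' : PBond P k) :
    dw1P hd ρ k χ p b' = ∑ p' : TPlaq P k, curl 1 (boxSingle χ b') p' * ∑ j ∈ Finset.range k, dtT hd ρ k j p p' :=
  map_w1P_eq_sum (curlAt ((P.L : ℝ) ^ k) p) hd ρ χ b'

/-- **THE EXACT REDUCTION OF `∂*w′₁` ON THE TORUS**: `(∂*w′₁)(x, b′) = Σ_{p′∈T₁^{(k)}} (∂□e_{b′})(p′)·Σ_{j<k} (∂*T_j)(x, p′)` for every fine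
site `x` and unit bond `b′`. [cite: BalabanImbrieJaffe1988, (5.4.3) p.282] -/
theorem sw1P_eq_sum (hd : 2 ≤ P.d) (ρ : ℕ → ℝ) (χ : PBond P k → ℝ) (x : TSite P 0) (b' : PBond P k) :
    sw1P hd ρ k χ x b' = ∑ p' : TPlaq P k, curl 1 (boxSingle χ b') p' * ∑ j ∈ Finset.range k, stT hd ρ k j x p' :=
  map_w1P_eq_sum (divAt ((P.L : ℝ) ^ k) x) hd ρ χ b'

/-- the shape used for the bound: `|(∂w′₁)(p, b′)| ≤ Σ_{p′} |(∂□e_{b′})(p′)|·|Σ_{j<k} (∂T_j)(p, p′)|`. [cite: BalabanImbrieJaffe1988, (5.4.3) p.282] -/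
theorem abs_dw1P_le_sum (hd : 2 ≤ P.d) (ρ : ℕ → ℝ) (χ : PBond P k → ℝ) (p : TPlaq P 0) (b' : PBond P k) :
    |dw1P hd ρ k χ p b'| ≤ ∑ p' : TPlaq P k, |curl 1 (boxSingle χ b') p'| * |∑ j ∈ Finset.range k, dtT hd ρ k j p p'| := by
  rw [dw1P_eq_sum]
  refine (Finset.abs_sum_le_sum_abs _ _).trans (Finset.sum_le_sum fun p' _ => ?_)
  rw [abs_mul]

/-- the shape used for the bound: `|(∂*w′₁)(x, b′)| ≤ Σ_{p′} |(∂□e_{b′})(p′)|·|Σ_{j<k} (∂*T_j)(x, p′)|`. [cite: BalabanImbrieJaffe1988, (5.4.3) p.282] -/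
theorem abs_sw1P_le_sum (hd : 2 ≤ P.d) (ρ : ℕ → ℝ) (χ : PBond P k → ℝ) (x : TSite P 0) (b' : PBond P k) :
    |sw1P hd ρ k χ x b'| ≤ ∑ p' : TPlaq P k, |curl 1 (boxSingle χ b') p'| * |∑ j ∈ Finset.range k, stT hd ρ k j x p'| := by
  rw [sw1P_eq_sum]
  refine (Finset.abs_sum_le_sum_abs _ _).trans (Finset.sum_le_sum fun p' _ => ?_)
  rw [abs_mul]

/-! ## §4  The tail terms: the output derivative lands on the left factor only -/

variable {j : ℕ}

/-- `T_j(·, p′)` as a linear combination of the columns `H_j(·, b₁)`, `H_{j,loc}(·, b₁)` with the scalar coefficients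
`C^{(j)}(b₁,b₂)G_j(b₂;p′)`, `C^{(j)}_{loc}(b₁,b₂)G_{j,loc}(b₂;p′)` (p02's `tT`, function form). [cite: BalabanImbrieJaffe1988, (5.4.3) p.282] -/
theorem tT_fun_eq (hd : 2 ≤ P.d) (ρ : ℕ → ℝ) (j : ℕ) (p' : TPlaq P k) :
    (fun b : PBond P 0 => tT hd ρ k j b p') = ∑ b₁ : PBond P j, ∑ b₂ : PBond P j,
      ((cKer (P := P) ((P.eta k) ^ P.d) ((P.L : ℝ) ^ k) j b₁ b₂ * gT hd k j b₂ p') •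
          (fun b : PBond P 0 => hKer (P := P) ((P.eta k) ^ P.d) ((P.L : ℝ) ^ k) j b b₁) -
        (clKer (P := P) ((P.eta k) ^ P.d) ((P.L : ℝ) ^ k) (ρ j / 4) j b₁ b₂ * glT hd ρ k j b₂ p') •
          (fun b : PBond P 0 => hlKer (P := P) ((P.eta k) ^ P.d) ((P.L : ℝ) ^ k) (ρ j / 16) (ρ j / 8) j b b₁)) := by
  funext b
  unfold tT
  simp only [Finset.sum_apply, Pi.sub_apply, Pi.smul_apply, smul_eq_mul]
  exact Finset.sum_congr rfl fun b₁ _ => Finset.sum_congr rfl fun b₂ _ => by ring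

/-- **ANY LINEAR FUNCTIONAL OF THE OUTPUT VARIABLE LANDS ON THE LEFT FACTOR**:
`Φ[T_j(·, p′)] = Σ_{b₁,b₂}[Φ[H_j(·,b₁)]C^{(j)}(b₁,b₂)G_j(b₂;p′) − Φ[H_{j,loc}(·,b₁)]C^{(j)}_{loc}(b₁,b₂)G_{j,loc}(b₂;p′)]`.
[cite: BalabanImbrieJaffe1988, (5.4.3) p.282] -/
theorem map_tT_eq_sum (Φ : (PBond P 0 → ℝ) →ₗ[ℝ] ℝ) (hd : 2 ≤ P.d) (ρ : ℕ → ℝ) (j : ℕ) (p' : TPlaq P k) :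
    Φ (fun b : PBond P 0 => tT hd ρ k j b p') = ∑ b₁ : PBond P j, ∑ b₂ : PBond P j,
      (Φ (fun b : PBond P 0 => hKer (P := P) ((P.eta k) ^ P.d) ((P.L : ℝ) ^ k) j b b₁) *
          cKer (P := P) ((P.eta k) ^ P.d) ((P.L : ℝ) ^ k) j b₁ b₂ * gT hd k j b₂ p' -
        Φ (fun b : PBond P 0 => hlKer (P := P) ((P.eta k) ^ P.d) ((P.L : ℝ) ^ k) (ρ j / 16) (ρ j / 8) j b b₁) *
          clKer (P := P) ((P.eta k) ^ P.d) ((P.L : ℝ) ^ k) (ρ j / 4) j b₁ b₂ * glT hd ρ k j b₂ p') := by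
  rw [tT_fun_eq, map_sum]
  refine Finset.sum_congr rfl fun b₁ _ => ?_
  rw [map_sum]
  refine Finset.sum_congr rfl fun b₂ _ => ?_
  rw [map_sub, map_smul, map_smul, smul_eq_mul, smul_eq_mul]
  ring

/-- **`(∂T_j)(p, p′) = Σ_{b₁,b₂}[(∂H_j(·,b₁))(p)C^{(j)}(b₁,b₂)G_j(b₂;p′) − (∂H_{j,loc}(·,b₁))(p)C^{(j)}_{loc}(b₁,b₂)G_{j,loc}(b₂;p′)]`** — the output
curl differentiates the left factor `H_j(·, b₁)` / `H_{j,loc}(·, b₁)` only. [cite: BalabanImbrieJaffe1988, (5.4.3) p.282] -/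
theorem dtT_eq_sum (hd : 2 ≤ P.d) (ρ : ℕ → ℝ) (j : ℕ) (p : TPlaq P 0) (p' : TPlaq P k) :
    dtT hd ρ k j p p' = ∑ b₁ : PBond P j, ∑ b₂ : PBond P j,
      (curl ((P.L : ℝ) ^ k) (fun b : PBond P 0 => hKer (P := P) ((P.eta k) ^ P.d) ((P.L : ℝ) ^ k) j b b₁) p *
          cKer (P := P) ((P.eta k) ^ P.d) ((P.L : ℝ) ^ k) j b₁ b₂ * gT hd k j b₂ p' -
        curl ((P.L : ℝ) ^ k) (fun b : PBond P 0 => hlKer (P := P) ((P.eta k) ^ P.d) ((P.L : ℝ) ^ k) (ρ j / 16) (ρ j / 8) j b b₁) p *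
          clKer (P := P) ((P.eta k) ^ P.d) ((P.L : ℝ) ^ k) (ρ j / 4) j b₁ b₂ * glT hd ρ k j b₂ p') :=
  map_tT_eq_sum (curlAt ((P.L : ℝ) ^ k) p) hd ρ j p'

/-- **`(∂*T_j)(x, p′) = Σ_{b₁,b₂}[(∂*H_j(·,b₁))(x)C^{(j)}(b₁,b₂)G_j(b₂;p′) − (∂*H_{j,loc}(·,b₁))(x)C^{(j)}_{loc}(b₁,b₂)G_{j,loc}(b₂;p′)]`**.
[cite: BalabanImbrieJaffe1988, (5.4.3) p.282] -/
theorem stT_eq_sum (hd : 2 ≤ P.d) (ρ : ℕ → ℝ) (j : ℕ) (x : TSite P 0) (p' : TPlaq P k) :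
    stT hd ρ k j x p' = ∑ b₁ : PBond P j, ∑ b₂ : PBond P j,
      (diverg ((P.L : ℝ) ^ k) (fun b : PBond P 0 => hKer (P := P) ((P.eta k) ^ P.d) ((P.L : ℝ) ^ k) j b b₁) x *
          cKer (P := P) ((P.eta k) ^ P.d) ((P.L : ℝ) ^ k) j b₁ b₂ * gT hd k j b₂ p' -
        diverg ((P.L : ℝ) ^ k) (fun b : PBond P 0 => hlKer (P := P) ((P.eta k) ^ P.d) ((P.L : ℝ) ^ k) (ρ j / 16) (ρ j / 8) j b b₁) x *
          clKer (P := P) ((P.eta k) ^ P.d) ((P.L : ℝ) ^ k) (ρ j / 4) j b₁ b₂ * glT hd ρ k j b₂ p') :=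
  map_tT_eq_sum (divAt ((P.L : ℝ) ^ k) x) hd ρ j p'

/-- **THE TELESCOPED THREE-TERM SPLIT UNDER A LINEAR FUNCTIONAL**: with `H = H_j(·,b₁)`, `H_l = H_{j,loc}(·,b₁)`, `C = C^{(j)}(b₁,b₂)`,
`C_l = C^{(j)}_{loc}(b₁,b₂)`, `G = G_j(b₂;p′)`, `G_l = G_{j,loc}(b₂;p′)`:
`Φ[T_j(·,p′)] = Σ_{b₁,b₂}(Φ[H − H_l]·CG + Φ[H_l]·(C − C_l)G + Φ[H_l]·C_l(G − G_l))` — each summand carries exactly one «small» difference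
((2.7) for `H − H_loc`, the `C`-side closeness for `C − C_loc`, the right factor's closeness for `G − G_loc`).
[cite: BalabanImbrieJaffe1988, (5.4.3) p.282] -/
theorem map_tT_eq_telescope (Φ : (PBond P 0 → ℝ) →ₗ[ℝ] ℝ) (hd : 2 ≤ P.d) (ρ : ℕ → ℝ) (j : ℕ) (p' : TPlaq P k) :
    Φ (fun b : PBond P 0 => tT hd ρ k j b p') = ∑ b₁ : PBond P j, ∑ b₂ : PBond P j,
      (Φ (fun b : PBond P 0 => hKer (P := P) ((P.eta k) ^ P.d) ((P.L : ℝ) ^ k) j b b₁ -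
            hlKer (P := P) ((P.eta k) ^ P.d) ((P.L : ℝ) ^ k) (ρ j / 16) (ρ j / 8) j b b₁) *
          (cKer (P := P) ((P.eta k) ^ P.d) ((P.L : ℝ) ^ k) j b₁ b₂ * gT hd k j b₂ p') +
        Φ (fun b : PBond P 0 => hlKer (P := P) ((P.eta k) ^ P.d) ((P.L : ℝ) ^ k) (ρ j / 16) (ρ j / 8) j b b₁) *
          ((cKer (P := P) ((P.eta k) ^ P.d) ((P.L : ℝ) ^ k) j b₁ b₂ -
              clKer (P := P) ((P.eta k) ^ P.d) ((P.L : ℝ) ^ k) (ρ j / 4) j b₁ b₂) * gT hd k j b₂ p') +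
        Φ (fun b : PBond P 0 => hlKer (P := P) ((P.eta k) ^ P.d) ((P.L : ℝ) ^ k) (ρ j / 16) (ρ j / 8) j b b₁) *
          (clKer (P := P) ((P.eta k) ^ P.d) ((P.L : ℝ) ^ k) (ρ j / 4) j b₁ b₂ * (gT hd k j b₂ p' - glT hd ρ k j b₂ p'))) := by
  rw [map_tT_eq_sum]
  refine Finset.sum_congr rfl fun b₁ _ => Finset.sum_congr rfl fun b₂ _ => ?_
  have hsub : Φ (fun b : PBond P 0 => hKer (P := P) ((P.eta k) ^ P.d) ((P.L : ℝ) ^ k) j b b₁ -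
        hlKer (P := P) ((P.eta k) ^ P.d) ((P.L : ℝ) ^ k) (ρ j / 16) (ρ j / 8) j b b₁) =
      Φ (fun b : PBond P 0 => hKer (P := P) ((P.eta k) ^ P.d) ((P.L : ℝ) ^ k) j b b₁) -
        Φ (fun b : PBond P 0 => hlKer (P := P) ((P.eta k) ^ P.d) ((P.L : ℝ) ^ k) (ρ j / 16) (ρ j / 8) j b b₁) := by
    rw [← map_sub]
    rfl
  rw [hsub]
  ring

/-- **THE TELESCOPED SPLIT OF `(∂T_j)(p, p′)`**: `Σ_{b₁,b₂}((∂(H_j − H_{j,loc})(·,b₁))(p)·CG + (∂H_{j,loc}(·,b₁))(p)·(C − C_loc)G +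
(∂H_{j,loc}(·,b₁))(p)·C_loc(G − G_loc))`. [cite: BalabanImbrieJaffe1988, (5.4.3) p.282] -/
theorem dtT_eq_telescope (hd : 2 ≤ P.d) (ρ : ℕ → ℝ) (j : ℕ) (p : TPlaq P 0) (p' : TPlaq P k) :
    dtT hd ρ k j p p' = ∑ b₁ : PBond P j, ∑ b₂ : PBond P j,
      (curl ((P.L : ℝ) ^ k) (fun b : PBond P 0 => hKer (P := P) ((P.eta k) ^ P.d) ((P.L : ℝ) ^ k) j b b₁ -
            hlKer (P := P) ((P.eta k) ^ P.d) ((P.L : ℝ) ^ k) (ρ j / 16) (ρ j / 8) j b b₁) p *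
          (cKer (P := P) ((P.eta k) ^ P.d) ((P.L : ℝ) ^ k) j b₁ b₂ * gT hd k j b₂ p') +
        curl ((P.L : ℝ) ^ k) (fun b : PBond P 0 => hlKer (P := P) ((P.eta k) ^ P.d) ((P.L : ℝ) ^ k) (ρ j / 16) (ρ j / 8) j b b₁) p *
          ((cKer (P := P) ((P.eta k) ^ P.d) ((P.L : ℝ) ^ k) j b₁ b₂ -
              clKer (P := P) ((P.eta k) ^ P.d) ((P.L : ℝ) ^ k) (ρ j / 4) j b₁ b₂) * gT hd k j b₂ p') +
        curl ((P.L : ℝ) ^ k) (fun b : PBond P 0 => hlKer (P := P) ((P.eta k) ^ P.d) ((P.L : ℝ) ^ k) (ρ j / 16) (ρ j / 8) j b b₁) p *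
          (clKer (P := P) ((P.eta k) ^ P.d) ((P.L : ℝ) ^ k) (ρ j / 4) j b₁ b₂ * (gT hd k j b₂ p' - glT hd ρ k j b₂ p'))) :=
  map_tT_eq_telescope (curlAt ((P.L : ℝ) ^ k) p) hd ρ j p'

/-- **THE TELESCOPED SPLIT OF `(∂*T_j)(x, p′)`** (divergence in place of the curl). [cite: BalabanImbrieJaffe1988, (5.4.3) p.282] -/
theorem stT_eq_telescope (hd : 2 ≤ P.d) (ρ : ℕ → ℝ) (j : ℕ) (x : TSite P 0) (p' : TPlaq P k) :
    stT hd ρ k j x p' = ∑ b₁ : PBond P j, ∑ b₂ : PBond P j,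
      (diverg ((P.L : ℝ) ^ k) (fun b : PBond P 0 => hKer (P := P) ((P.eta k) ^ P.d) ((P.L : ℝ) ^ k) j b b₁ -
            hlKer (P := P) ((P.eta k) ^ P.d) ((P.L : ℝ) ^ k) (ρ j / 16) (ρ j / 8) j b b₁) x *
          (cKer (P := P) ((P.eta k) ^ P.d) ((P.L : ℝ) ^ k) j b₁ b₂ * gT hd k j b₂ p') +
        diverg ((P.L : ℝ) ^ k) (fun b : PBond P 0 => hlKer (P := P) ((P.eta k) ^ P.d) ((P.L : ℝ) ^ k) (ρ j / 16) (ρ j / 8) j b b₁) x *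
          ((cKer (P := P) ((P.eta k) ^ P.d) ((P.L : ℝ) ^ k) j b₁ b₂ -
              clKer (P := P) ((P.eta k) ^ P.d) ((P.L : ℝ) ^ k) (ρ j / 4) j b₁ b₂) * gT hd k j b₂ p') +
        diverg ((P.L : ℝ) ^ k) (fun b : PBond P 0 => hlKer (P := P) ((P.eta k) ^ P.d) ((P.L : ℝ) ^ k) (ρ j / 16) (ρ j / 8) j b b₁) x *
          (clKer (P := P) ((P.eta k) ^ P.d) ((P.L : ℝ) ^ k) (ρ j / 4) j b₁ b₂ * (gT hd k j b₂ p' - glT hd ρ k j b₂ p'))) :=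
  map_tT_eq_telescope (divAt ((P.L : ℝ) ^ k) x) hd ρ j p'

end

end Literature.MathematicalPhysics.QuantumFieldTheory.BalabanImbrieJaffe1984to88.BIJ88W1Prime543CurlDivTorus
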